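import Summits.QuantumFields.YangMills.Theorems.ParabolicTrajectoryContinuumLimitOnTrajectoryRegimeTrisectionCloses

/-!
# Route-context READ-BACK of the strategist's split children (crux stmt-QuantumFields-10522)

Imports exactly what the route file `Theses/ParabolicTrajectory.lean` would import after the split (its current imports
+ `MassGapFromLatticeClustering` for `SpeciesScheme.HasCSClustering`), replicates its `open` lines, and renders the three
children VERBATIM as `children.json` states them (one-line Props with an `open … in` prefix), inside the route namespace —
i.e. exactly as the gate would write them. Then proves the split glue `V → I → U → ContinuumLimitOnTrajectory` against
the LIVE crux decl in this context (the proof a prover pastes for the glue item if `--glue-by` is unavailable).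
Scratch (not landed). rc 0, 0 sorry expected.
-/

namespace Summit.QuantumFields.YangMills.Theses.ParabolicTrajectory.SplitScratch

open scoped BigOperators Topology Manifold Classical MeasureTheory ProbabilityTheory Matrix InnerProductSpace ComplexConjugate ContinuousMap
open Filter Set Function TopologicalSpace MeasureTheory

/-- child V (route-item rendering). -/
def ForcedVolumeGrowth : Prop :=
  open Literature.MathematicalPhysics.QuantumFieldTheory Literature.MathematicalPhysics.QuantumLattice Literature.MathematicalPhysics.AQFT Classical in ∀ (G : Type) [Group G] [TopologicalSpace G] [IsTopologicalGroup G] [CompactSpace G] [MeasurableSpace G] [BorelSpace G], IsCompactSimpleLieGroup G → ∀ (r : LatticeRep G) (M : ℕ) (θ Δ : ℝ) (sch : SpeciesScheme (YMSpecies G)) (n : ℕ → ℕ), 0 < θ → 0 < Δ → (∀ k, sch.a k = ((M : ℝ) ^ n k)⁻¹) → Filter.Tendsto sch.β Filter.atTop Filter.atTop → (∀ t : ℕ, 0 < t → ∃ c : ℝ, Filter.Tendsto (fun k => ((M : ℝ) ^ n k) ^ 8 * latticeConnectedCorr r.ρ (sch.β k) (sch.side k) r.curvature.F r.curvature.F (t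 * M ^ n k)) Filter.atTop (nhds c)) → Filter.Tendsto (fun k => ((M : ℝ) ^ n k) ^ 8 * latticeConnectedCorr r.ρ (sch.β k) (sch.side k) r.curvature.F r.curvature.F (M ^ n k)) Filter.atTop (nhds θ) → HasLatticeMassGap r sch Δ → ∃ N : ℕ, 1 ≤ N ∧ ∀ᶠ k in Filter.atTop, (sch.a k)⁻¹ ≤ (sch.a k * (sch.L k : ℝ)) ^ N

/-- child I (route-item rendering). -/
def ClusteringOnTrajectory : Prop :=
  open Literature.MathematicalPhysics.QuantumFieldTheory Literature.MathematicalPhysics.QuantumLattice Literature.MathematicalPhysics.AQFT Classical in ∀ (G : Type) [Group G] [TopologicalSpace G] [IsTopologicalGroup G] [CompactSpace G] [MeasurableSpace G] [BorelSpace G], IsCompactSimpleLieGroup G → ∀ (r : LatticeRep G) (M : ℕ) (θ Δ : ℝ) (sch : SpeciesScheme (YMSpecies G)) (n : ℕ → ℕ), 0 < θ → 0 < Δ → (∀ k, sch.a k = ((M : ℝ) ^ n k)⁻¹) → Filter.Tendsto sch.β Filter.atTop Filter.atTop → (∀ t : ℕ, 0 < t → ∃ c : ℝ, Filter.Tendsto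 (fun k => ((M : ℝ) ^ n k) ^ 8 * latticeConnectedCorr r.ρ (sch.β k) (sch.side k) r.curvature.F r.curvature.F (t * M ^ n k)) Filter.atTop (nhds c)) → Filter.Tendsto (fun k => ((M : ℝ) ^ n k) ^ 8 * latticeConnectedCorr r.ρ (sch.β k) (sch.side k) r.curvature.F r.curvature.F (M ^ n k)) Filter.atTop (nhds θ) → HasLatticeMassGap r sch Δ → (∃ N : ℕ, 1 ≤ N ∧ ∀ᶠ k in Filter.atTop, (sch.a k)⁻¹ ≤ (sch.a k * (sch.L k : ℝ)) ^ N) → let cn : SpeciesScheme (YMSpecies G) := { a := sch.a, a_pos := sch.a_pos, tendsto_a := sch.tendsto_a, β := sch.β, L := sch.L, tendsto_L := sch.tendsto_L, c := fun s k => if s = r.curvature then ((sch.a k) ^ 4)⁻¹ else 0, m := fun s k => wilsonTorusMean r.ρ (sch.β k) (sch.L k) s.F }; ((∀ (p : ℕ) (f : Fin p → SchwartzMap (EuclideanSpace ℝ (Fin 4)) ℝ), IsOffDiagonal (SchwartzMap.tensorFin p fun i => ofRealTest (f i)) → ∀ ε : ℝ, 0 < ε → ∀ᶠ k in Filter.atTop,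 ∀ L : ℕ, sch.L k ≤ L → |latticeSchwinger r.ρ cn (fun s => s.F) k p (fun _ => r.curvature) f - wilsonCentredSchwinger r.ρ (sch.β k) L (fun _ => 1) p (fun _ => r.curvature) (fun i => (blockDilate M)^[n k] (f i))| ≤ ε) ∧ (∀ t : ℕ, 0 < t → ∀ ε : ℝ, 0 < ε → ∀ᶠ k in Filter.atTop, ∀ S : ℕ, sch.L k ≤ S → ((M : ℝ) ^ n k) ^ 8 * |latticeConnectedCorr r.ρ (sch.β k) (sch.side k) r.curvature.F r.curvature.F (t * M ^ n k) - latticeConnectedCorr r.ρ (sch.β k) (2 * S + 1) r.curvature.F r.curvature.F (t * M ^ n k)| ≤ ε)) ∧ ∃ Δ₁ : ℝ, 0 < Δ₁ ∧ SpeciesScheme.HasCSClustering r cn Δ₁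

/-- child U (route-item rendering). -/
def UltravioletLimitOnTrajectory : Prop :=
  open Literature.MathematicalPhysics.QuantumFieldTheory Literature.MathematicalPhysics.QuantumLattice Literature.MathematicalPhysics.AQFT Classical in ∀ (G : Type) [Group G] [TopologicalSpace G] [IsTopologicalGroup G] [CompactSpace G] [MeasurableSpace G] [BorelSpace G], IsCompactSimpleLieGroup G → ∀ (r : LatticeRep G), ∃ M₀ : ℕ, ∀ M : ℕ, M₀ ≤ M → 2 ≤ M → ∃ θ₀ : ℝ, 0 < θ₀ ∧ ∀ (θ Δ : ℝ) (sch : SpeciesScheme (YMSpecies G)) (n : ℕ → ℕ), 0 < θ → θ < θ₀ → 0 < Δ → (∀ k, sch.a k = ((M : ℝ) ^ n k)⁻¹) → Filter.Tendsto sch.β Filter.atTop Filter.atTop → (∀ t : ℕ, 0 < t → ∃ c : ℝ, Filter.Tendsto (fun k => ((M : ℝ) ^ n k) ^ 8 * latticeConnectedCorr r.ρ (sch.β k) (sch.side k) r.curvature.F r.curvature.F (t * M ^ n k)) Filter.atTop (nhds c)) → Filter.Tendsto (fun k => ((M : ℝ) ^ n k) ^ 8 * latticeConnectedCorr r.ρ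 (sch.β k) (sch.side k) r.curvature.F r.curvature.F (M ^ n k)) Filter.atTop (nhds θ) → HasLatticeMassGap r sch Δ → (∃ N : ℕ, 1 ≤ N ∧ ∀ᶠ k in Filter.atTop, (sch.a k)⁻¹ ≤ (sch.a k * (sch.L k : ℝ)) ^ N) → let cn : SpeciesScheme (YMSpecies G) := { a := sch.a, a_pos := sch.a_pos, tendsto_a := sch.tendsto_a, β := sch.β, L := sch.L, tendsto_L := sch.tendsto_L, c := fun s k => if s = r.curvature then ((sch.a k) ^ 4)⁻¹ else 0, m := fun s k => wilsonTorusMean r.ρ (sch.β k) (sch.L k) s.F }; ((∀ (p : ℕ) (f : Fin p → SchwartzMap (EuclideanSpace ℝ (Fin 4)) ℝ), IsOffDiagonal (SchwartzMap.tensorFin p fun i => ofRealTest (f i)) → ∀ ε : ℝ, 0 < ε → ∀ᶠ k in Filter.atTop, ∀ L : ℕ, sch.L k ≤ L → |latticeSchwinger r.ρ cn (fun s => s.F) k p (fun _ => r.curvature) f - wilsonCentredSchwinger r.ρ (sch.β k) L (fun _ => 1) p (fun _ => r.curvature) (fun i => (blockDilate M)^[n k] (f i))| ≤ ε) ∧ (∀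 t : ℕ, 0 < t → ∀ ε : ℝ, 0 < ε → ∀ᶠ k in Filter.atTop, ∀ S : ℕ, sch.L k ≤ S → ((M : ℝ) ^ n k) ^ 8 * |latticeConnectedCorr r.ρ (sch.β k) (sch.side k) r.curvature.F r.curvature.F (t * M ^ n k) - latticeConnectedCorr r.ρ (sch.β k) (2 * S + 1) r.curvature.F r.curvature.F (t * M ^ n k)| ≤ ε)) → (∃ Δ₁ : ℝ, 0 < Δ₁ ∧ SpeciesScheme.HasCSClustering r cn Δ₁) → ∃ sch' : SpeciesScheme (YMSpecies G), sch'.a = sch.a ∧ sch'.β = sch.β ∧ sch'.L = sch.L ∧ ∃ T : OSData (YMSpecies G) 4, IsYangMillsFor r sch' T ∧ T.IsNontrivial r.curvature ∧ T.IsNonGaussian r.curvature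


open Summit.QuantumFields.YangMills.Cruxes.ContinuumLimitOnTrajectory in
/-- defeq read-back V -/
theorem v_iff : ForcedVolumeGrowth ↔ RegimeTrisection.ForcedVolumeGrowth := Iff.rfl

open Summit.QuantumFields.YangMills.Cruxes.ContinuumLimitOnTrajectory in
/-- defeq read-back I -/
theorem i_iff : ClusteringOnTrajectory ↔ RegimeTrisection.ClusteringOnTrajectory := Iff.rfl

open Summit.QuantumFields.YangMills.Cruxes.ContinuumLimitOnTrajectory in
/-- defeq read-back U -/
theorem u_iff : UltravioletLimitOnTrajectory ↔ RegimeTrisection.UltravioletLimitOnTrajectory := Iff.rfl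

open Summit.QuantumFields.YangMills.Cruxes.ContinuumLimitOnTrajectory in
/-- the --glue-by decl typechecks against route-namespace renderings of the children -/
theorem glue_by : ForcedVolumeGrowth → ClusteringOnTrajectory → UltravioletLimitOnTrajectory → ContinuumLimitOnTrajectory :=
  RegimeTrisection.ContinuumLimitOnTrajectory_of_subs

open Summit.QuantumFields.YangMills.Cruxes.ContinuumLimitOnTrajectory
  Summit.QuantumFields.YangMills.Cruxes.ContinuumLimitOnTrajectory.TwoOrbitSynchronisation in
/-- the rev-8 closes one-liner typechecks -/
theorem closes8 : UltravioletLimitOnTrajectory → ClusteringOnTrajectory → LatticeGapOnTrajectory → TunedSequenceExistsPVG → YangMills :=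
  RegimeTrisection.yangMills_of_subs

end Summit.QuantumFields.YangMills.Theses.ParabolicTrajectory.SplitScratch
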